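import Mathlib

/-!
# T6A2LefCarrier — the carrier (data only) for the Lefschetz (1,1) displays of sub-claim A2 (S2)

Cell pub-hodge-repro2, Tier 6 (README §10), seat t6-p2 (A2 owner). Definition lane. This file holds the DATA
over which the two printed statements behind TIER4 Prop. A4.2.4 are displayed in `T6A2Hyp.lean`: Voisin I,
Theorem 11.30 (Lefschetz' theorem on (1,1) classes: `Hdg²(X, ℤ) = c₁(Pic X)`) and Corollary 11.34 (on a
projective manifold the Chern classes of line bundles are the classes of divisors). The carrier has NO Prop
field: everything the print asserts is a displayed hypothesis. Rational classes are DEFINED as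
`H²(X, ℚ) := ℚ ⊗[ℤ] H²(X, ℤ)` (`H2Q`), their complexification `toCQ` is induced by `toC`.

What is deliberately NOT here: Kähler / projective geometry (a space is just an element of `Space` with a
predicate `IsProjective`), the definition of `Pic`, `c₁`, divisors and their classes (data), the cycle-class
map of Fulton (the identification of Voisin's class of a divisor with Fulton's `cl` is TIER4 A2 GAPS (i)
and is Layer III's identification datum, TARGET-T6.md §2).
-/

namespace Summit.Ventures.HodgeRepro2.T6.A2LefCarrier

universe u

/-- The carrier of the Lefschetz (1,1) displays, DATA ONLY: spaces (compact Kähler manifolds, with the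
projective ones marked), `H²(X, ℤ)`, `H²(X, ℂ)` with its `(1,1)`-part, the complexification, the group
`Pic X` of isomorphism classes of holomorphic line bundles with `c₁ : Pic X → H²(X, ℤ)`, and the divisors
(cycles of codimension 1) with their classes in `H²(X, ℤ)` (Voisin I, Chapter 11). -/
structure LefschetzCarrier where
  /-- the spaces (compact Kähler manifolds) -/
  Space : Type u
  /-- the complex projective manifolds among them -/
  IsProjective : Space → Prop
  /-- `H²(X, ℤ)` -/
  H2Z : Space → Type u
  /-- additive group structure -/
  [instAddCommGroupH2Z : ∀ X, AddCommGroup (H2Z X)]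
  /-- `H²(X, ℂ)` -/
  H2C : Space → Type u
  /-- additive group structure -/
  [instAddCommGroupH2C : ∀ X, AddCommGroup (H2C X)]
  /-- ℂ-vector space structure -/
  [instModuleH2C : ∀ X, Module ℂ (H2C X)]
  /-- the map `H²(X, ℤ) → H²(X, ℂ)` (change of coefficients) -/
  toC : ∀ X, H2Z X →+ H2C X
  /-- the Hodge component `H^{1,1}(X) ⊂ H²(X, ℂ)` -/
  H11 : ∀ X, Submodule ℂ (H2C X)
  /-- `Pic X`, the group of isomorphism classes of holomorphic line bundles over `X` -/
  Pic : Space → Type u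
  /-- the first Chern class `c₁ : Pic X → H²(X, ℤ)` -/
  c1 : ∀ X, Pic X → H2Z X
  /-- the divisors of `X` (cycles of codimension 1) -/
  Div : Space → Type u
  /-- the cohomology class `[D] ∈ H²(X, ℤ)` of a divisor -/
  clDiv : ∀ X, Div X → H2Z X

attribute [instance] LefschetzCarrier.instAddCommGroupH2Z LefschetzCarrier.instAddCommGroupH2C
  LefschetzCarrier.instModuleH2C

namespace LefschetzCarrier

variable (T : LefschetzCarrier.{u})

/-- Rational cohomology, DEFINED as `H²(X, ℚ) := ℚ ⊗[ℤ] H²(X, ℤ)` (TIER4 A2 Prop. A4.2.4, Conclusion: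
"`H²(X, ℚ) = H²(X, ℤ) ⊗ ℚ`"). -/
abbrev H2Q (X : T.Space) : Type u := TensorProduct ℤ ℚ (T.H2Z X)

/-- The rational class `1 ⊗ m` of an integral class `m`. -/
def toQ (X : T.Space) (m : T.H2Z X) : T.H2Q X := (1 : ℚ) ⊗ₜ[ℤ] m

/-- The ℤ-bilinear map `(q, m) ↦ q • toC m` behind the complexification of rational classes. -/
noncomputable def toCQbil (X : T.Space) : ℚ →ₗ[ℤ] T.H2Z X →ₗ[ℤ] T.H2C X where
  toFun q := (q : ℂ) • (T.toC X).toIntLinearMap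
  map_add' q q' := by
    ext m
    simp [add_smul]
  map_smul' n q := by
    ext m
    simp only [LinearMap.smul_apply, zsmul_eq_mul, Rat.cast_mul, Rat.cast_intCast, mul_smul,
      RingHom.id_apply]
    rw [Int.cast_smul_eq_zsmul]

/-- The complexification `H²(X, ℚ) → H²(X, ℂ)` induced by `toC`: `q ⊗ m ↦ q • toC m` (ℤ-linear). -/
noncomputable def toCQ (X : T.Space) : T.H2Q X →ₗ[ℤ] T.H2C X :=
  TensorProduct.lift (T.toCQbil X)

end LefschetzCarrier

end Summit.Ventures.HodgeRepro2.T6.A2LefCarrier
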